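import Mathlib
import Literature.Computability.AlgebraicComplexity.RazElusiveGeneralRouteProofs
import Literature.Computability.AlgebraicComplexity.RazElusiveGeneralDischarge
import Summits.ValiantsHypothesis.ValiantsHypothesis.Statement
import Summits.ValiantsHypothesis.ValiantsHypothesis.Theorems.SoloInformedQuadSpanReduction
import HarnessLib

/-!
# Polynomial sections suffice: `VP = VNP` forces the design monomials into the quadratic span
# of polynomially many POLYNOMIALS (solo seat `solo-ValiantsHypothesis-informed`, s30)

All earlier reductions of this seat (`SoloInformedQuadSpanWindow`, `SoloInformedMultivariateWindow`)
go through elusiveness: `VP = VNP` makes the design map `x ↦ (x^{S_i})_i` non-`(s, 2)`-elusive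
(Raz 2010, Cor. 5.8), and image containment `Image(f) ⊂ Image(Γ)` only yields ALGEBRAIC sections
`b_j ∈ \overline{ℂ(x)}` with `x^{S_i} ∈ span{b_j b_k}` (Garg–Makam–Oliveira–Wigderson, Lemma 9.3).
The hypotheses of those theorems therefore quantify over all algebraic functions.

This file observes that Raz's own argument gives far more.  The structural core of his
Proposition 2.7 — a degree-`r` form `g` computed by `L` gates is `∑_t A_t B_t` over `L (r+1)`
slots with `deg A_t, deg B_t ≤ ⌊2r/3⌋` — is proved in the tree over an ARBITRARY commutative
semiring of coefficients (`exists_sum_mul_of_circuit`).  Run it over the coefficient ring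
`K = F[x_1, …, x_n]` on Raz's polynomial `f̃ ∈ F[X, Z]` read as a form of degree `r` in `Z` with
coefficients in `K` (this is `f̃|_a` at the generic point `a = (x_1, …, x_n) ∈ Kⁿ`; a circuit for
`f̃` over `F` is a circuit for it over `K`, `complexity_map_le`, and the substitution is a
projection, `isProjection_razTildeAt`).  Comparing `Z`-coefficients (`H(f̃|_a) = f(a)`, Prop. 5.4)
exhibits every coordinate `f_j ∈ F[X]` as an `F`-linear combination of products `y y'` of the
`Z`-coefficients `y ∈ K = F[X]` of the `A_t, B_t`:

* `soloPolyRealised_of_complexity` — for `3 ≤ r`, `1 ≤ n` and ANY `f : Fⁿ → F^{C(n+r-1,r)}`: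
  the coordinates `f_j` lie in the `F`-span of the pairwise products of at most
  `4 · C(n+r'-1, r') · r³ · (L(f̃) + n)` POLYNOMIALS `y ∈ F[x_1, …, x_n]` (`r' = ⌊2r/3⌋`) — the
  same count as Raz's Cor. 5.7, with polynomial instead of merely existing sections and with no
  field extension;
* `soloInformed_per_not_pComputable_of_not_polyRealised` — Cor. 5.8 with elusiveness replaced by
  "eventually `f n` is not realised in the quadratic span of `s n` polynomials" (same side
  conditions, same definability, proof word for word that of `Raz2010_cor_5_8_of_parts` with the
  polynomial lemma in place of Cor. 5.7; Prop. 5.5 and Valiant's completeness from the tree's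
  discharged facts);
* `soloInformed_vp_ne_vnp_of_polyWindow_pointwise` — the same over `ℂ` for set families
  `S n` and the monomial maps `x ↦ (x^{S_i})_i` (`SoloPolyRealisedFamily`).

The window / log-order / fixed-order forms with polynomial sections on few variables
((Q*-poly) implies `ValiantsHypothesis`) are in `SoloInformedPolynomialWindow`, the reduction to
HOMOGENEOUS sections of degree `≤ max_i |S_i|` in `SoloInformedHomogeneousSections`.  Only the
implications are claimed; every hypothesis of those forms is OPEN (seat notes `paper/quadspan.md`
§2.10).

References: R. Raz, Elusive functions and lower bounds for arithmetic circuits, Theory of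
Computing 6 (2010) 135–177, Prop. 2.7 (pp. 152–153), Props. 5.1–5.6, Cor. 5.7, Cor. 5.8
[Raz2010]; P. Bürgisser, Completeness and reduction in algebraic complexity theory (2000), §4.1
(extension of scalars) [Burgisser2000].
-/

noncomputable section

open MvPolynomial Finset

namespace Summit.ValiantsHypothesis.ValiantsHypothesis.Theorems

open Literature.Computability.AlgebraicComplexity

universe u

/-! ### Realisation in the quadratic span of `s` polynomials -/

section General

variable {F : Type u}

/-- `f_1, …, f_m ∈ F[σ]` are REALISED BY `s` POLYNOMIAL SECTIONS: there are
`y_1, …, y_s ∈ F[σ]` such that every `f_j` is an `F`-linear combination of the products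
`y_i y_k`. [cite: Raz2010, Def. 1.1 (p. 140), cf. Prop. 5.1] -/
def SoloPolyRealised [CommSemiring F] {σ : Type*} {m : ℕ} (s : ℕ)
    (f : Fin m → MvPolynomial σ F) : Prop :=
  ∃ y : Fin s → MvPolynomial σ F,
    ∀ j, f j ∈ Submodule.span F (Set.range fun p : Fin s × Fin s => y p.1 * y p.2)

/-- More sections realise at least as much (pad with zeros). [folklore] -/
theorem SoloPolyRealised.mono [CommSemiring F] {σ : Type*} {m s s' : ℕ}
    {f : Fin m → MvPolynomial σ F} (hf : SoloPolyRealised s f) (h : s ≤ s') :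
    SoloPolyRealised s' f := by
  classical
  obtain ⟨y, hy⟩ := hf
  refine ⟨fun i => if hi : (i : ℕ) < s then y ⟨i, hi⟩ else 0,
    fun j => Submodule.span_mono ?_ (hy j)⟩
  rintro _ ⟨p, rfl⟩
  exact ⟨(Fin.castLE h p.1, Fin.castLE h p.2), by simp⟩

/-- Sections indexed by any finite type give `SoloPolyRealised (card ι)`. [folklore] -/
theorem soloPolyRealised_of_fintype [CommSemiring F] {σ ι : Type*} [Fintype ι] {m : ℕ}
    {f : Fin m → MvPolynomial σ F} (y : ι → MvPolynomial σ F)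
    (hy : ∀ j, f j ∈ Submodule.span F (Set.range fun p : ι × ι => y p.1 * y p.2)) :
    SoloPolyRealised (Fintype.card ι) f := by
  classical
  let φ := Fintype.equivFin ι
  refine ⟨y ∘ φ.symm, fun j => Submodule.span_mono ?_ (hy j)⟩
  rintro _ ⟨p, rfl⟩
  exact ⟨(φ p.1, φ p.2), by simp [φ]⟩

/-- **Polynomial sections from a small circuit for `f̃` (Raz 2010, Prop. 2.7 run over the
coefficient ring `F[X]`).**  For `3 ≤ r`, `1 ≤ n` and any `f = (f_j)_j : Fⁿ → F^{C(n+r-1, r)}`,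
the coordinates `f_j ∈ F[x_1, …, x_n]` lie in the `F`-span of the pairwise products of at most
`4 · C(n+r'-1, r') · r³ · (L(f̃) + n)` polynomials `y ∈ F[x_1, …, x_n]`, `r' = ⌊2r/3⌋`,
`L(f̃)` the circuit complexity of Raz's `f̃ ∈ F[X, Z]` over `F`.  Proof: `f̃|_a` at the generic
point `a = (x_i)_i` over `K = F[X]` is a degree-`r` form in `Z` of complexity `≤ L(f̃)` over `K`
(`isProjection_razTildeAt`, `map_razTilde`, `complexity_map_le`), hence `∑_t A_t B_t` with
`deg_Z A_t, deg_Z B_t ≤ r'` (`exists_sum_mul_of_circuit` over `K`); its `Z`-coefficients are the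
`f_j` (Prop. 5.4, `lexCoeffs_razTildeAt`), and the `Z`-coefficient of `h⁻¹(j)` in `A_t B_t` is
`∑_{b + b' = h⁻¹(j)} [A_t]_b [B_t]_{b'}` with `[A_t]_b = 0` unless `deg b ≤ r'`.
[cite: Raz2010, Prop. 2.7 (pp. 152–153), Props. 5.1–5.4 (pp. 168–171)] -/
theorem soloPolyRealised_of_complexity [CommSemiring F] {n r : ℕ} (hr : 3 ≤ r) (hn : 1 ≤ n)
    (f : Fin (Nat.choose (n + r - 1) r) → MvPolynomial (Fin n) F) :
    SoloPolyRealised (4 * Nat.choose (n + 2 * r / 3 - 1) (2 * r / 3) * r ^ 3 *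
      (complexity (razTilde f) + n)) f := by
  classical
  set e := 2 * r / 3 with he
  set L := complexity (razTilde f) with hL
  let K := MvPolynomial (Fin n) F
  let fK : Fin (Nat.choose (n + r - 1) r) → MvPolynomial (Fin n) K :=
    fun j => MvPolynomial.map (algebraMap F K) (f j)
  let g : MvPolynomial (Fin n) K := razTildeAt fK fun i => (X i : K)
  have hghom : g.IsHomogeneous r := isHomogeneous_razTildeAt fK _
  have hgL : complexity g ≤ L :=
    calc complexity g ≤ complexity (razTilde fK) :=
          complexity_le_of_isProjection (isProjection_razTildeAt fK _)
      _ = complexity (MvPolynomial.map (algebraMap F K) (razTilde f)) := by rw [map_razTilde]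
      _ ≤ complexity (razTilde f) := ArithCircuit.complexity_map_le _ _
  -- the `Z`-coefficients of `g = f̃|_{(x_i)}` are the `f_j`
  have hcoef : ∀ j, coeff (lexMonomial n r j) g = f j := by
    intro j
    have h := congrFun (lexCoeffs_razTildeAt fK fun i => (X i : K)) j
    rw [lexCoeffs_apply, polyMapEval_apply] at h
    rw [h]
    show eval (fun i => (X i : K)) (MvPolynomial.map (algebraMap F K) (f j)) = f j
    rw [MvPolynomial.eval_map, MvPolynomial.algebraMap_eq, MvPolynomial.eval₂_eta]
  -- Raz's Prop. 2.7 over `K`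
  obtain ⟨P, hP2, hPg, hPs⟩ := ArithCircuit.exists_computes_size_eq_complexity g
  obtain ⟨A, B, hA, hB, hgAB⟩ :=
    exists_sum_mul_of_circuit hr hP2 (hPs.trans_le hgL : P.size ≤ L) hPg hghom
  -- the sections: all `Z`-coefficients of degree `≤ e` of the `A_t` and the `B_t`
  let V := (Fin L × Fin (r + 1)) × Bool × ↥(lowMonomials n e)
  let y : V → K := fun v => coeff (v.2.2 : Fin n →₀ ℕ) (bif v.2.1 then B v.1 else A v.1)
  have hreal : ∀ j, f j ∈ Submodule.span F (Set.range fun p : V × V => y p.1 * y p.2) := by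
    intro j
    rw [← hcoef j, hgAB, coeff_sum]
    refine Submodule.sum_mem _ fun t _ => ?_
    rw [coeff_mul]
    refine Submodule.sum_mem _ fun x _ => ?_
    by_cases h1 : (x.1).degree ≤ e
    · by_cases h2 : (x.2).degree ≤ e
      · refine Submodule.subset_span ⟨((t, false, ⟨x.1, mem_lowMonomials.2 h1⟩),
          (t, true, ⟨x.2, mem_lowMonomials.2 h2⟩)), ?_⟩
        simp [y]
      · have h0 : coeff x.2 (B t) = 0 :=
          coeff_eq_zero_of_totalDegree_lt (lt_of_le_of_lt (hB t) (not_le.mp h2))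
        rw [h0, mul_zero]
        exact Submodule.zero_mem _
    · have h0 : coeff x.1 (A t) = 0 :=
        coeff_eq_zero_of_totalDegree_lt (lt_of_le_of_lt (hA t) (not_le.mp h1))
      rw [h0, zero_mul]
      exact Submodule.zero_mem _
  -- count
  have hcard : Fintype.card V ≤ 4 * Nat.choose (n + e - 1) e * r ^ 3 * (L + n) := by
    have hc : Fintype.card V = L * (r + 1) * (2 * (lowMonomials n e).card) := by
      simp only [V, Fintype.card_prod, Fintype.card_fin, Fintype.card_bool, Fintype.card_coe]
    rw [hc]
    calc L * (r + 1) * (2 * (lowMonomials n e).card)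
        ≤ L * (2 * r) * (2 * (r * Nat.choose (n + e - 1) e)) := by
          have h1 : r + 1 ≤ 2 * r := by omega
          have h2 : (lowMonomials n e).card ≤ r * Nat.choose (n + e - 1) e :=
            (card_lowMonomials_le hn).trans (Nat.mul_le_mul_right _ (by omega))
          gcongr
      _ = 4 * Nat.choose (n + e - 1) e * (r ^ 2 * L) := by ring
      _ ≤ 4 * Nat.choose (n + e - 1) e * (r ^ 3 * (L + n)) :=
          Nat.mul_le_mul_left _ (Nat.mul_le_mul (Nat.pow_le_pow_right (by omega) (by norm_num))
            (Nat.le_add_right L n))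
      _ = 4 * Nat.choose (n + e - 1) e * r ^ 3 * (L + n) := by ring
  exact (soloPolyRealised_of_fintype y hreal).mono hcard

/-- **Raz 2010, Cor. 5.8 with polynomial sections in place of elusiveness.**  Let `char F ≠ 2`,
`3 ≤ r ≤ n ≤ s` eventually, `s / C(n+r'-1, r') ≥ n^{ω(1)}`, and `f : Fⁿ → F^{C(n+r-1,r)}`
poly(`n`)-definable (Def. 1.3).  If eventually `f n` is NOT realised in the quadratic span of
`s n` polynomials of `F[x_1, …, x_n]`, then the permanent family over `F` is not p-computable.
Proof as printed for Cor. 5.8 (`Raz2010_cor_5_8_of_parts`): Prop. 5.5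
(`Raz2010_prop_5_5_holds`), Valiant's completeness (`isVNPComplete_perPoly_holds`), and
`soloPolyRealised_of_complexity` in place of Cor. 5.7.
[cite: Raz2010, Cor. 5.8 (p. 172), Prop. 5.5 (p. 171), Prop. 2.7 (pp. 152–153)] -/
theorem soloInformed_per_not_pComputable_of_not_polyRealised {F : Type u} [Field F]
    (hchar : ringChar F ≠ 2) (r s : ℕ → ℕ)
    (f : ∀ n : ℕ, Fin (Nat.choose (n + r n - 1) (r n)) → MvPolynomial (Fin n) F)
    (hpar : ∃ n₀ : ℕ, ∀ n ≥ n₀, 3 ≤ r n ∧ r n ≤ n ∧ n ≤ s n)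
    (hgrow : ∀ c : ℕ, ∃ n₀ : ℕ, ∀ n ≥ n₀,
      n ^ c * Nat.choose (n + 2 * r n / 3 - 1) (2 * r n / 3) ≤ s n)
    (hexp : IsPolyDefinableMap (m := fun n => Nat.choose (n + r n - 1) (r n))
      (σ := fun n => Fin n) f)
    (hnr : ∃ n₀ : ℕ, ∀ n ≥ n₀, ¬ SoloPolyRealised (s n) (f n)) :
    ¬ IsPComputable (fun N => perPoly (Fin N) F) := by
  intro hper
  -- Prop. 5.5: `f̃` is poly(n)-definable, hence a `VNP` family (in `2n` variables).
  have hpar' : ∃ n₀ : ℕ, ∀ n ≥ n₀, 3 ≤ r n ∧ r n ≤ n := by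
    obtain ⟨n₀, h⟩ := hpar
    exact ⟨n₀, fun n hn => ⟨(h n hn).1, (h n hn).2.1⟩⟩
  have hdef : IsPolyDefinable (σ := fun n => Fin n ⊕ Fin n)
      fun n => razTilde (n := n) (r := r n) (f n) := Raz2010_prop_5_5_holds F r f hpar' hexp
  have hcard : IsPBounded fun n => Fintype.card (Fin n ⊕ Fin n) := by
    have h : (fun n => Fintype.card (Fin n ⊕ Fin n)) = fun n => _root_.id n + _root_.id n := by
      funext n
      rw [Fintype.card_sum, Fintype.card_fin]
      rfl
    rw [h]
    exact IsPBounded.add_holds IsPBounded.id IsPBounded.id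
  have hvnp : IsVNPFamily (σ := fun n => Fin n ⊕ Fin n)
      fun n => razTilde (n := n) (r := r n) (f n) := hdef.isVNPFamily hcard
  -- Valiant: `f̃` (renamed to `Fin (n + n)` variables) is a p-projection of `PER`.
  have hvnp' : IsVNPFamily fun n => renameEquiv F finSumFinEquiv
      (razTilde (n := n) (r := r n) (f n)) :=
    (isVNPFamily_renameEquiv_iff (σ := fun n => Fin n ⊕ Fin n) (fun n => finSumFinEquiv) _).2 hvnp
  have hproj : IsPProjection (fun n => renameEquiv F finSumFinEquiv
      (razTilde (n := n) (r := r n) (f n))) (fun N => perPoly (Fin N) F) :=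
    ((isVNPComplete_perPoly_holds F) hchar).2 (fun n => n + n) _ hvnp'
  -- Since `PER` is p-computable, `n ↦ L(f̃ n)` is p-bounded.
  have hcomp : IsPComputable fun n => renameEquiv F finSumFinEquiv
      (razTilde (n := n) (r := r n) (f n)) :=
    IsPComputable.of_isPProjection_holds hproj hper
  have hL : IsPBounded fun n => complexity (razTilde (n := n) (r := r n) (f n)) :=
    IsPBounded.mono hcomp fun n => (complexity_renameEquiv_holds _ _).symm.le
  obtain ⟨c₁, hc₁⟩ : IsPBounded fun n => complexity (razTilde (n := n) (r := r n) (f n)) + n :=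
    IsPBounded.add_holds hL IsPBounded.id
  -- Polynomial sections (Prop. 2.7 over `F[X]`) against the growth hypothesis.
  obtain ⟨n₁, hnr₁⟩ := hnr
  obtain ⟨n₂, hgr⟩ := hgrow (c₁ + 5)
  obtain ⟨n₀, hp⟩ := hpar
  obtain ⟨N, hN⟩ := eventually_mul_cube_mul_lt_pow 4 c₁
  have key : ∀ n, n₀ ≤ n → n₁ ≤ n → n₂ ≤ n → N ≤ n → False := by
    intro n h0 h1 h2 h3
    obtain ⟨h3r, hrn, -⟩ := hp n h0
    refine hnr₁ n h1 ((soloPolyRealised_of_complexity h3r (by omega) (f n)).mono ?_)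
    calc 4 * Nat.choose (n + 2 * r n / 3 - 1) (2 * r n / 3) * r n ^ 3 *
          (complexity (razTilde (n := n) (r := r n) (f n)) + n)
        ≤ 4 * Nat.choose (n + 2 * r n / 3 - 1) (2 * r n / 3) * n ^ 3 * (n ^ c₁ + c₁) :=
          Nat.mul_le_mul (Nat.mul_le_mul_left _ (Nat.pow_le_pow_left hrn 3)) (hc₁ n)
      _ = 4 * (n ^ 3 * (n ^ c₁ + c₁)) * Nat.choose (n + 2 * r n / 3 - 1) (2 * r n / 3) := by
          ring
      _ ≤ n ^ (c₁ + 5) * Nat.choose (n + 2 * r n / 3 - 1) (2 * r n / 3) :=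
          Nat.mul_le_mul_right _ (hN n h3).le
      _ ≤ s n := hgr n h2
  exact key (n₀ + n₁ + n₂ + N) (by omega) (by omega) (by omega) (by omega)

end General

/-! ### The window form with polynomial sections, over `ℂ` -/

/-- The set family `S` is REALISED BY THE POLYNOMIAL SECTIONS `y_1, …, y_s ∈ ℂ[x_1, …, x_n]`:
every monomial `x^{S_i} = ∏_{r ∈ S_i} x_r` (`soloDesignMap S i`) is a `ℂ`-linear combination of
the products `y_j y_k`. [cite: Raz2010, Def. 1.1 (p. 140)] -/
def SoloPolyRealisedFamily {s m n : ℕ} (y : Fin s → MvPolynomial (Fin n) ℂ)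
    (S : Fin m → Finset (Fin n)) : Prop :=
  ∀ i, soloDesignMap S i ∈ Submodule.span ℂ (Set.range fun p : Fin s × Fin s => y p.1 * y p.2)

/-- **The polynomial-sections reduction, pointwise form.**  Set families
`S n : Fin C(n + r n - 1, r n) → Finset (Fin n)`, Raz's side conditions on `r, s`, the statement
"no `s n` POLYNOMIALS of `ℂ[x_1, …, x_n]` realise `S n` in their quadratic span" eventually, and
Def. 1.3 definability of the monomial maps give `VP ℂ ≠ VNP ℂ`.
[cite: Raz2010, Cor. 5.8 (p. 172), Prop. 2.7 (pp. 152–153)] -/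
theorem soloInformed_vp_ne_vnp_of_polyWindow_pointwise {r s : ℕ → ℕ}
    (S : ∀ n, Fin (Nat.choose (n + r n - 1) (r n)) → Finset (Fin n))
    (hpar : ∃ n₀ : ℕ, ∀ n ≥ n₀, 3 ≤ r n ∧ r n ≤ n ∧ n ≤ s n)
    (hgrow : ∀ c : ℕ, ∃ n₀ : ℕ, ∀ n ≥ n₀,
      n ^ c * Nat.choose (n + 2 * r n / 3 - 1) (2 * r n / 3) ≤ s n)
    (hQm : ∃ n₀ : ℕ, ∀ n ≥ n₀, ∀ y : Fin (s n) → MvPolynomial (Fin n) ℂ,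
      ¬ SoloPolyRealisedFamily y (S n))
    (hdef : IsPolyDefinableMap (m := fun n => Nat.choose (n + r n - 1) (r n))
      (σ := fun n => Fin n) fun n => soloDesignMap (S n)) :
    VP ℂ ≠ VNP ℂ := by
  refine perNotPComputableComplex_iff_holds.mp ?_
  refine soloInformed_per_not_pComputable_of_not_polyRealised ringChar_complex_ne_two r s
    (fun n => soloDesignMap (S n)) hpar hgrow hdef ?_
  obtain ⟨n₀, h0⟩ := hQm
  refine ⟨n₀, fun n hn hreal => ?_⟩
  obtain ⟨y, hy⟩ := hreal
  exact h0 n hn y fun i => hy i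

end Summit.ValiantsHypothesis.ValiantsHypothesis.Theorems

end
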